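import Literature.Probability.RandomPlanarGeometry.BDGS2012GrahamIdentity
import HarnessLib

/-!
# Graham's Borel-type bound for `z_c(d)` (BDGS 2012, (1.20)), X: counting tools for the lace
# graphs with a long piece — chains of self-avoiding walks and the marking inequality

Sibling file of `Literature.Probability.RandomPlanarGeometry.BDGS2012` (fact
`BDGS2012_Graham_criticalPoint_bound` = Graham 2010, Theorem 1), sequel to
`BDGS2012GrahamIdentity.lean`. At infinite memory the lace graphs whose pieces are longer than the
cap `K₀` (Graham's memory `τ`; here `diagTotalGt` of `BDGS2012GrahamPieces.lean`) must be shown to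
be exponentially rare in `d` at the critical point. The device is the elementary **marking
inequality**: choosing `p` interior times of an `n`-step self-avoiding walk and cutting there gives
`p + 1` self-avoiding walks glued end to end, and the map is injective, so
`C(n-1, p) · cₙ(x) ≤ (c^{*(p+1)})ₙ(x)` (the `(p+1)`-fold space-time convolution of the counts
`c_m(y)`, `m ≥ 1`), whose generating function is the convolution power `H_z^{*(p+1)}` of
`H_z = G_z - δ` — a quantity controlled by the converged lace expansion.

## What is formalised (namespace `Literature.Probability.RandomPlanarGeometry.SAW.Zd.Graham2010`)

* `chainCount d n k x` — the number of `n`-tuples of self-avoiding walks of positive lengths with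
  total length `k` and total displacement `x` (`(c^{*n})_k(x)`), by the recursion in `n`;
  `chainCount_one`;
* `countAt_add_le_sum` — `c_{i+j}(x) ≤ Σ_b c_i(b) c_j(x - b)` (cut a self-avoiding walk at time `i`;
  from `SAWLace.card_filter_twoPiece_le`);
* **`choose_mul_countAt_le_chainCount`** — `C(k-1, p) · c_k(x) ≤ chainCount d (p+1) k x` for
  `k ≥ p + 1` (hockey-stick induction on `p`);
* `card_profSet_le_saw` — the sequential bound of `BDGS2012GrahamPieces.lean` with self-avoiding
  piece counts `c_k(x) ≤ Q' k` in place of simple-random-walk counts (every piece of a lace graph is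
  self-avoiding; the closed first piece is a self-avoiding walk to a neighbour of `0` plus a step,
  `card_filter_loop_le`), `card_profSet_mul_pow_le` (the weighted per-profile form), and
  **`sum_diagTotalGt_mul_pow_le`** — with `w(n) = (n+1) Q'(n) zⁿ` and `2dz ≤ 2`,
  `Σ_{a≤A} z^a diagTotalGt d a M K ≤ 4(M+1) (Σ_{K≤n≤A} w n) (Σ_{1≤n≤A} w n)^M`: the lace graphs with
  a piece longer than `K` cost the TAIL of the piece series (Graham's "`τ < ∞`" truncation error,
  here an explicit class of graphs at `τ = ∞`).

Not here: the generating functions and the Fourier bounds (next files).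
-/

noncomputable section

open Finset
open scoped BigOperators
open Literature.Probability.LatticeModels Literature.Probability.LatticeModels.SRW
open Literature.Barriers.CriticalPhenomena Literature.Barriers.CriticalPhenomena.SAWLace

namespace Literature.Probability.RandomPlanarGeometry.SAW.Zd.Graham2010

variable {d : ℕ}

/-! ### Chains of self-avoiding walks -/

/-- `chainCount d n k x = (c^{*n})_k(x)`: the number of `n`-tuples `(ω₁, …, ωₙ)` of self-avoiding
walks of positive lengths `ℓᵢ ≥ 1` with `Σ ℓᵢ = k` and total displacement `x` (no mutual avoidance).
[folklore] -/
def chainCount (d : ℕ) : ℕ → ℕ → Site d → ℕ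
  | 0, k, x => if k = 0 ∧ x = 0 then 1 else 0
  | n + 1, k, x => ∑ j ∈ Finset.range k, ∑ b ∈ box d j, chainCount d n j b * countAt d (k - j) (x - b)

/-- The empty chain. [folklore] -/
theorem chainCount_zero (k : ℕ) (x : Site d) : chainCount d 0 k x = if k = 0 ∧ x = 0 then 1 else 0 := by
  rw [chainCount]

/-- The recursion. [folklore] -/
theorem chainCount_succ (n k : ℕ) (x : Site d) :
    chainCount d (n + 1) k x = ∑ j ∈ Finset.range k, ∑ b ∈ box d j, chainCount d n j b * countAt d (k - j) (x - b) := by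
  rw [chainCount]

/-- One piece: `chainCount d 1 k x = c_k(x)` for `k ≥ 1` (and `0` for `k = 0`). [folklore] -/
theorem chainCount_one (k : ℕ) (x : Site d) : chainCount d 1 k x = if k = 0 then 0 else countAt d k x := by
  rw [chainCount_succ]
  rcases Nat.eq_zero_or_pos k with rfl | hk
  · simp
  · rw [if_neg hk.ne', Finset.sum_eq_single 0]
    · rw [Finset.sum_eq_single 0]
      · rw [chainCount_zero, if_pos ⟨rfl, rfl⟩, one_mul, Nat.sub_zero, sub_zero]
      · intro b _ hb
        rw [chainCount_zero, if_neg (fun h => hb h.2), zero_mul]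
      · intro h
        exact absurd (zero_mem_box d 0) h
    · intro j hj hj0
      refine Finset.sum_eq_zero fun b _ => ?_
      rw [chainCount_zero, if_neg (fun h => hj0 h.1), zero_mul]
    · intro h
      exact absurd (Finset.mem_range.2 hk) h

/-! ### Cutting a self-avoiding walk at a fixed time -/

/-- **`c_{i+j}(x) ≤ Σ_b c_i(b) c_j(x - b)`**: cut an `(i+j)`-step self-avoiding walk at time `i`.
[folklore] -/
theorem countAt_add_le_sum (i j : ℕ) (x : Site d) :
    countAt d (i + j) x ≤ ∑ b ∈ box d i, countAt d i b * countAt d j (x - b) := by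
  classical
  -- `c_{i+j}(x) = #sawSet`, fibre over `b = ω(i) ∈ box d i`
  rw [← card_sawSet, sawSet]
  rw [Finset.card_eq_sum_card_fiberwise (f := fun τ : StepSeq d (i + j) => pos τ i) (t := box d i)
    fun τ _ => pos_mem_box τ i]
  refine Finset.sum_le_sum fun b _ => ?_
  rw [Finset.filter_filter]
  refine le_trans (Finset.card_le_card fun τ hτ => ?_) (card_filter_twoPiece_le i j b x)
  rw [Finset.mem_filter] at hτ ⊢
  obtain ⟨-, ⟨hinj, hend⟩, hb⟩ := hτ
  exact ⟨Finset.mem_univ _, ⟨hinj.mono (Set.Icc_subset_Icc_right (Nat.le_add_right i j)), hb⟩,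
    hinj.mono (Set.Icc_subset_Icc_left (Nat.zero_le i)), hend⟩

/-! ### The marking inequality -/

/-- Hockey stick in the form used: `Σ_{j=1}^{k-1} C(j-1, p) = C(k-1, p+1)` (`k ≥ 2`). [folklore] -/
theorem sum_Ico_choose_pred (p k : ℕ) (hk : 2 ≤ k) :
    ∑ j ∈ Finset.Ico 1 k, (j - 1).choose p = (k - 1).choose (p + 1) := by
  have h := Nat.sum_Icc_choose (k - 2) p
  rw [show k - 2 + 1 = k - 1 by omega] at h
  rw [← h, Finset.sum_Ico_eq_sum_range]
  simp only [Nat.add_sub_cancel_left]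
  symm
  refine Finset.sum_subset (fun m hm => ?_) fun m hm hm' => ?_
  · rw [Finset.mem_Icc] at hm; rw [Finset.mem_range]; omega
  · rw [Finset.mem_range] at hm
    rw [Finset.mem_Icc, not_and_or, not_le, not_le] at hm'
    rcases hm' with h1 | h2
    · exact Nat.choose_eq_zero_of_lt h1
    · omega

/-- **The marking inequality**: `C(k-1, p) · c_k(x) ≤ chainCount d (p+1) k x` for `k ≥ p + 1` —
choosing `p` interior cut times of a `k`-step self-avoiding walk (`C(k-1,p)` ways) and cutting gives
`p + 1` self-avoiding walks of positive lengths, injectively. [folklore] -/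
theorem choose_mul_countAt_le_chainCount (p : ℕ) :
    ∀ (k : ℕ) (x : Site d), p + 1 ≤ k → (k - 1).choose p * countAt d k x ≤ chainCount d (p + 1) k x := by
  induction p with
  | zero =>
    intro k x hk
    rw [Nat.choose_zero_right, one_mul, chainCount_one, if_neg (by omega)]
  | succ p ih =>
    intro k x hk
    -- `C(k-1, p+1) c_k(x) = Σ_{j=1}^{k-1} C(j-1,p) c_k(x) ≤ Σ_j C(j-1,p) Σ_b c_j(b) c_{k-j}(x-b)`
    rw [← sum_Ico_choose_pred p k (by omega), Finset.sum_mul, chainCount_succ]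
    calc ∑ j ∈ Finset.Ico 1 k, (j - 1).choose p * countAt d k x
        ≤ ∑ j ∈ Finset.Ico 1 k, (j - 1).choose p * ∑ b ∈ box d j, countAt d j b * countAt d (k - j) (x - b) := by
          refine Finset.sum_le_sum fun j hj => Nat.mul_le_mul_left _ ?_
          rw [Finset.mem_Ico] at hj
          have := countAt_add_le_sum j (k - j) x
          rwa [Nat.add_sub_cancel' hj.2.le] at this
      _ = ∑ j ∈ Finset.Ico 1 k, ∑ b ∈ box d j, ((j - 1).choose p * countAt d j b) * countAt d (k - j) (x - b) := by
          refine Finset.sum_congr rfl fun j _ => ?_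
          rw [Finset.mul_sum]
          exact Finset.sum_congr rfl fun b _ => by ring
      _ ≤ ∑ j ∈ Finset.Ico 1 k, ∑ b ∈ box d j, chainCount d (p + 1) j b * countAt d (k - j) (x - b) := by
          refine Finset.sum_le_sum fun j hj => Finset.sum_le_sum fun b _ => Nat.mul_le_mul_right _ ?_
          rw [Finset.mem_Ico] at hj
          by_cases hjp : p + 1 ≤ j
          · exact ih j b hjp
          · rw [Nat.choose_eq_zero_of_lt (by omega), zero_mul]; exact Nat.zero_le _
      _ ≤ ∑ j ∈ Finset.range k, ∑ b ∈ box d j, chainCount d (p + 1) j b * countAt d (k - j) (x - b) :=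
          Finset.sum_le_sum_of_subset_of_nonneg (fun j hj => by
            rw [Finset.mem_Ico] at hj; rw [Finset.mem_range]; exact hj.2) fun _ _ _ => Nat.zero_le _

/-! ### The sequential bound with self-avoiding piece counts -/

/-- The number of self-avoiding `k`-step walks ending on one of the sites `y s`, `s ∈ [lo, m]`, is at
most `(m + 1 - lo) · Q' k` when `c_k(x) ≤ Q' k` for all `x`. [folklore] -/
theorem card_filter_saw_exists_endpoint_le {Q' : ℕ → ℕ} (hQ' : ∀ k (x : Site d), countAt d k x ≤ Q' k)
    (k lo m : ℕ) (y : ℕ → Site d)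
    [DecidablePred fun σ₂ : StepSeq d k =>
      Set.InjOn (pos σ₂) (Set.Icc 0 k) ∧ ∃ s ∈ Finset.Icc lo m, pos σ₂ k = y s] :
    (Finset.univ.filter fun σ₂ : StepSeq d k =>
      Set.InjOn (pos σ₂) (Set.Icc 0 k) ∧ ∃ s ∈ Finset.Icc lo m, pos σ₂ k = y s).card ≤ (m + 1 - lo) * Q' k := by
  classical
  have hsub : (Finset.univ.filter fun σ₂ : StepSeq d k =>
      Set.InjOn (pos σ₂) (Set.Icc 0 k) ∧ ∃ s ∈ Finset.Icc lo m, pos σ₂ k = y s) ⊆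
      (Finset.Icc lo m).biUnion fun s => sawSet d k (y s) := by
    intro σ₂ hσ₂
    rw [Finset.mem_filter] at hσ₂
    obtain ⟨-, hinj, s, hs, hpos⟩ := hσ₂
    rw [Finset.mem_biUnion]
    exact ⟨s, hs, mem_sawSet.2 ⟨hinj, hpos⟩⟩
  calc _ ≤ ((Finset.Icc lo m).biUnion fun s => sawSet d k (y s)).card := Finset.card_le_card hsub
    _ ≤ ∑ s ∈ Finset.Icc lo m, (sawSet d k (y s)).card := Finset.card_biUnion_le
    _ ≤ ∑ _s ∈ Finset.Icc lo m, Q' k := Finset.sum_le_sum fun s _ => by rw [card_sawSet]; exact hQ' k (y s)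
    _ = (m + 1 - lo) * Q' k := by rw [Finset.sum_const, Nat.card_Icc, smul_eq_mul]

/-- A one-step walk is determined by its endpoint: `#{σ : StepSeq d 1 | v + pos σ 1 = 0} ≤ 1`. [folklore] -/
theorem card_filter_one_step_le (v : Site d) [DecidablePred fun σ₂ : StepSeq d 1 => v + pos σ₂ 1 = 0] :
    (Finset.univ.filter fun σ₂ : StepSeq d 1 => v + pos σ₂ 1 = 0).card ≤ 1 := by
  rw [Finset.card_le_one]
  intro σ hσ τ hτ
  rw [Finset.mem_filter] at hσ hτ
  have h1 : ∀ ρ : StepSeq d 1, pos ρ 1 = stepVec (ρ 0) := by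
    intro ρ
    have h := pos_succ ρ (Nat.lt_succ_self 0)
    rw [pos_zero, zero_add, zero_add] at h
    exact h
  have heq : stepVec (σ 0) = stepVec (τ 0) := by
    rw [← h1, ← h1]
    have := hσ.2; have := hτ.2
    exact add_left_cancel (hσ.2.trans hτ.2.symm)
  have h0 : σ 0 = τ 0 := stepVec_injective heq
  funext i
  rw [Fin.fin_one_eq_zero i]
  exact h0

/-- The closed first piece: the number of `(n+1)`-step walks returning to `0` at time `n + 1` and
self-avoiding on `[0, n]` is at most `2d · Q' n` (the first `n` steps form a self-avoiding walk to a
neighbour of the origin). [folklore] -/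
theorem card_filter_loop_le {Q' : ℕ → ℕ} (hQ' : ∀ k (x : Site d), countAt d k x ≤ Q' k) (n : ℕ)
    [DecidablePred fun σ : StepSeq d (n + 1) => Set.InjOn (pos σ) (Set.Icc 0 n) ∧ pos σ (n + 1) = 0] :
    (Finset.univ.filter fun σ : StepSeq d (n + 1) =>
      Set.InjOn (pos σ) (Set.Icc 0 n) ∧ pos σ (n + 1) = 0).card ≤ 2 * d * Q' n := by
  classical
  have hsplit := card_filter_le_sum_append (d := d) (m := n) (k := 1)
    (fun σ => Set.InjOn (pos σ) (Set.Icc 0 n) ∧ pos σ (n + 1) = 0)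
    (fun σ₁ => Set.InjOn (pos σ₁) (Set.Icc 0 n) ∧ ∃ e : Dir d, pos σ₁ n + stepVec e = 0)
    (fun σ₁ σ₂ => pos σ₁ n + pos σ₂ 1 = 0) ?_
  · refine hsplit.trans ?_
    calc ∑ σ₁ : StepSeq d n, (if Set.InjOn (pos σ₁) (Set.Icc 0 n) ∧ ∃ e : Dir d, pos σ₁ n + stepVec e = 0 then
          (Finset.univ.filter fun σ₂ : StepSeq d 1 => pos σ₁ n + pos σ₂ 1 = 0).card else 0)
        ≤ ∑ σ₁ : StepSeq d n, (if Set.InjOn (pos σ₁) (Set.Icc 0 n) ∧ ∃ e : Dir d, pos σ₁ n + stepVec e = 0 then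
            1 else 0) := by
          refine Finset.sum_le_sum fun σ₁ _ => ?_
          split_ifs
          · exact card_filter_one_step_le (pos σ₁ n)
          · exact le_rfl
      _ = (Finset.univ.filter fun σ₁ : StepSeq d n =>
            Set.InjOn (pos σ₁) (Set.Icc 0 n) ∧ ∃ e : Dir d, pos σ₁ n + stepVec e = 0).card := by
          rw [Finset.card_filter]
      _ ≤ (Finset.univ.biUnion fun e : Dir d => sawSet d n (-stepVec e)).card := by
          refine Finset.card_le_card fun σ₁ hσ₁ => ?_
          rw [Finset.mem_filter] at hσ₁
          obtain ⟨-, hinj, e, he⟩ := hσ₁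
          rw [Finset.mem_biUnion]
          exact ⟨e, Finset.mem_univ _, mem_sawSet.2 ⟨hinj, eq_neg_of_add_eq_zero_left he⟩⟩
      _ ≤ ∑ e : Dir d, (sawSet d n (-stepVec e)).card := Finset.card_biUnion_le
      _ ≤ ∑ _e : Dir d, Q' n := Finset.sum_le_sum fun e _ => by rw [card_sawSet]; exact hQ' n _
      _ = 2 * d * Q' n := by rw [Finset.sum_const, Finset.card_univ, card_dir, smul_eq_mul]
  · rintro σ₁ σ₂ ⟨hinj, hend⟩
    have hpos : ∀ s ≤ n, pos (Fin.append σ₁ σ₂) s = pos σ₁ s := fun s hs => pos_append_of_le _ _ hs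
    have hinj₁ : Set.InjOn (pos σ₁) (Set.Icc 0 n) := by
      intro s hs t ht hst
      rw [Set.mem_Icc] at hs ht
      exact hinj (Set.mem_Icc.2 hs) (Set.mem_Icc.2 ht) (by rw [hpos s hs.2, hpos t ht.2]; exact hst)
    have hsum : pos σ₁ n + pos σ₂ 1 = 0 := by rw [← pos_append_add, ← hend]
    refine ⟨⟨hinj₁, σ₂ 0, ?_⟩, hsum⟩
    have h1 : pos σ₂ 1 = stepVec (σ₂ 0) := by
      have h := pos_succ σ₂ (Nat.lt_succ_self 0)
      rw [pos_zero, zero_add, zero_add] at h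
      exact h
    rw [← h1]; exact hsum

/-- **The sequential bound with self-avoiding piece counts**: for any `Q'` with `c_k(x) ≤ Q' k`
(self-avoiding counts), the number of `a`-step lace graphs of order `M + 1` with lace times `t`
(`t M = a`) is at most `2d · Q'(t 0 - 1) · ∏_{i<M} (t i + 1 - prevT t i) · Q'(t (i+1) - t i)`
(each piece is self-avoiding; the closed first piece is a self-avoiding walk to a neighbour of `0`
plus one step). [cite: Graham2010, Lemma 7] -/
theorem card_profSet_le_saw {Q' : ℕ → ℕ} (hQ' : ∀ k (x : Site d), countAt d k x ≤ Q' k) (t : ℕ → ℕ) :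
    ∀ (M a : ℕ), t M = a →
      (profSet d a M t).card ≤ 2 * d * Q' (t 0 - 1) *
        ∏ i ∈ Finset.range M, ((t i + 1 - prevT t i) * Q' (t (i + 1) - t i)) := by
  classical
  intro M
  induction M with
  | zero =>
    intro a hta
    subst hta
    rw [Finset.range_zero, Finset.prod_empty, mul_one]
    rcases Nat.eq_zero_or_pos (t 0) with h0 | hpos
    · -- `a = 0`: no diagrams
      have : profSet d (t 0) 0 t = ∅ := by
        unfold profSet
        refine Finset.filter_eq_empty_iff.2 ?_
        rintro σ - ⟨hD, -⟩
        have := hD.add_two_le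
        omega
      rw [this, Finset.card_empty]; exact Nat.zero_le _
    · obtain ⟨n, hn⟩ : ∃ n, t 0 = n + 1 := ⟨t 0 - 1, by omega⟩
      have hsub : t 0 - 1 = n := by omega
      rw [hsub]
      -- transport to length `n + 1`
      have key : ∀ (b : ℕ) (hb : b = n + 1), t 0 = b → (profSet d b 0 t).card ≤ 2 * d * Q' n := by
        rintro b rfl htb
        refine le_trans (Finset.card_le_card fun σ hσ => ?_) (card_filter_loop_le hQ' n)
        unfold profSet at hσ
        rw [Finset.mem_filter] at hσ ⊢
        obtain ⟨-, hD, hT⟩ := hσ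
        have hT0 : laceTime σ 0 = n + 1 := (hT 0 le_rfl).trans htb
        obtain ⟨-, hmem⟩ := laceTime_spec hT0.le
        rw [pieceSet_zero, Set.mem_singleton_iff, hT0] at hmem
        refine ⟨Finset.mem_univ _, ?_, hmem⟩
        have hinj := hD.2.1
        rw [hT0] at hinj
        exact hinj.mono fun s hs => by rw [Set.mem_Icc] at hs; rw [Set.mem_Ico]; omega
      exact key (t 0) hn rfl
  | succ M ih =>
    intro a hta
    set m := t M with hm
    by_cases hma : m ≤ a
    swap
    · have : profSet d a (M + 1) t = ∅ := by
        unfold profSet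
        refine Finset.filter_eq_empty_iff.2 ?_
        rintro σ - ⟨hD, hT⟩
        have h1 : laceTime σ M ≤ laceTime σ (M + 1) := laceTime_le_succ σ M
        rw [hT M (Nat.le_succ M), hT (M + 1) le_rfl, hta] at h1
        exact hma h1
      rw [this, Finset.card_empty]
      exact Nat.zero_le _
    obtain ⟨k, rfl⟩ := Nat.exists_eq_add_of_le hma
    have hsplit := card_filter_le_sum_append (d := d) (m := m) (k := k)
      (fun σ => IsDiag σ (M + 1) ∧ ∀ i ≤ M + 1, laceTime σ i = t i)
      (fun σ₁ => IsDiag σ₁ M ∧ ∀ i ≤ M, laceTime σ₁ i = t i)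
      (fun σ₁ σ₂ => Set.InjOn (pos σ₂) (Set.Icc 0 k) ∧
        ∃ s ∈ Finset.Icc (prevT t M) m, pos σ₂ k = pos σ₁ s - pos σ₁ m) ?_
    · refine (le_of_eq (by unfold profSet; rfl)).trans (hsplit.trans ?_)
      calc ∑ σ₁ : StepSeq d m, (if IsDiag σ₁ M ∧ ∀ i ≤ M, laceTime σ₁ i = t i then
            (Finset.univ.filter fun σ₂ : StepSeq d k => Set.InjOn (pos σ₂) (Set.Icc 0 k) ∧
              ∃ s ∈ Finset.Icc (prevT t M) m, pos σ₂ k = pos σ₁ s - pos σ₁ m).card else 0)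
          ≤ ∑ σ₁ : StepSeq d m, (if IsDiag σ₁ M ∧ ∀ i ≤ M, laceTime σ₁ i = t i then
              (m + 1 - prevT t M) * Q' k else 0) := by
            refine Finset.sum_le_sum fun σ₁ _ => ?_
            split_ifs
            · exact card_filter_saw_exists_endpoint_le hQ' k (prevT t M) m (fun s => pos σ₁ s - pos σ₁ m)
            · exact le_rfl
        _ = (profSet d m M t).card * ((m + 1 - prevT t M) * Q' k) := by
            rw [← Finset.sum_filter, Finset.sum_const, smul_eq_mul]
            rfl
        _ ≤ (2 * d * Q' (t 0 - 1) * ∏ i ∈ Finset.range M, ((t i + 1 - prevT t i) * Q' (t (i + 1) - t i))) *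
              ((m + 1 - prevT t M) * Q' k) := Nat.mul_le_mul_right _ (ih m rfl)
        _ = 2 * d * Q' (t 0 - 1) *
              ∏ i ∈ Finset.range (M + 1), ((t i + 1 - prevT t i) * Q' (t (i + 1) - t i)) := by
            rw [Finset.prod_range_succ, hta, Nat.add_sub_cancel_left, ← hm, mul_assoc]
    · rintro σ₁ σ₂ ⟨hD, hT⟩
      have hTM : laceTime (Fin.append σ₁ σ₂) M = m := hT M (Nat.le_succ M)
      have hDM : IsDiag σ₁ M ∧ laceTime σ₁ M = m := (isDiag_append_iff σ₁ σ₂).1 ⟨hD.mono, hTM⟩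
      have hpos : ∀ s ≤ m, pos (Fin.append σ₁ σ₂) s = pos σ₁ s := fun s hs => pos_append_of_le _ _ hs
      have htimes : ∀ i ≤ M, laceTime σ₁ i = t i := by
        intro i hi
        rw [laceTime_congr (Nat.le_add_right m k) le_rfl (fun s hs => (hpos s hs).symm) hTM.le hi]
        exact hT i (Nat.le_succ_of_le hi)
      refine ⟨⟨hDM.1, htimes⟩, ?_, ?_⟩
      · -- the last piece `ω[T_M, T_{M+1}] = σ₂` is self-avoiding
        have hTa : laceTime (Fin.append σ₁ σ₂) (M + 1) = m + k := (hT (M + 1) le_rfl).trans hta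
        have hpiece := hD.2.2 (M + 1) (Nat.succ_pos M) le_rfl
        rw [laceStart_succ, hTM, hTa] at hpiece
        rw [← injOn_append_Icc_iff σ₁ σ₂ 0 k, Nat.add_zero]
        exact hpiece
      · have hTa : laceTime (Fin.append σ₁ σ₂) (M + 1) = m + k := (hT (M + 1) le_rfl).trans hta
        obtain ⟨-, s, hs, heq⟩ := laceTime_spec hTa.le
        simp only [prevLo_succ, laceStart_succ] at hs
        rw [Set.mem_Icc] at hs
        have hstart : laceStart (Fin.append σ₁ σ₂) M = prevT t M :=
          laceStart_eq_prevT fun i hi => hT i (Nat.le_succ_of_le hi)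
        rw [hstart, hTM] at hs
        refine ⟨s, Finset.mem_Icc.2 ⟨hs.1, hs.2⟩, ?_⟩
        rw [hTa, pos_append_add, hpos s hs.2] at heq
        rw [heq]
        abel

/-! ### The weighted bound on the lace graphs with a long piece -/

/-- `Σ_{b ∈ ⋃ᵢ tᵢ} f ≤ Σᵢ Σ_{b ∈ tᵢ} f` for `f ≥ 0`. [folklore] -/
theorem real_sum_biUnion_le {ι β : Type*} [DecidableEq β] (S : Finset ι) (t : ι → Finset β)
    (f : β → ℝ) (hf : ∀ b, 0 ≤ f b) :
    ∑ b ∈ S.biUnion t, f b ≤ ∑ i ∈ S, ∑ b ∈ t i, f b := by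
  classical
  induction S using Finset.induction_on with
  | empty => simp
  | insert i S hi ih =>
    rw [Finset.biUnion_insert, Finset.sum_insert hi]
    have h1 := Finset.sum_union_inter (s₁ := t i) (s₂ := S.biUnion t) (f := f)
    have h2 : 0 ≤ ∑ b ∈ t i ∩ S.biUnion t, f b := Finset.sum_nonneg fun b _ => hf b
    linarith

/-- The per-profile weighted bound: for a positive profile `k` (`k i ≥ 1`) with `Σ k_i = a`,
`z^a · #profSet ≤ 4 · w(k₀ - 1) · ∏_{i ≥ 1} w(k_i)` with `w(n) = (n+1) Q'(n) zⁿ`, when `2dz ≤ 2`.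
[cite: Graham2010, Lemma 7] -/
theorem card_profSet_mul_pow_le {Q' : ℕ → ℕ} (hQ' : ∀ k (x : Site d), countAt d k x ≤ Q' k)
    {z : ℝ} (hz : 0 ≤ z) (hdz : 2 * (d : ℝ) * z ≤ 2) {M a : ℕ} (k : Fin (M + 1) → ℕ)
    (hsum : ∑ i, k i = a) (hpos : ∀ i, 1 ≤ k i) :
    ((profSet d a M (partialSum k)).card : ℝ) * z ^ a ≤
      4 * ∏ i : Fin (M + 1), (if (i : ℕ) = 0 then
        (((k i - 1 : ℕ) : ℝ) + 1) * (Q' (k i - 1) : ℝ) * z ^ (k i - 1)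
        else ((k i : ℝ) + 1) * (Q' (k i) : ℝ) * z ^ (k i)) := by
  set w : ℕ → ℝ := fun n => ((n : ℝ) + 1) * (Q' n : ℝ) * z ^ n with hw
  have hw0 : ∀ n, 0 ≤ w n := fun n => by simp only [hw]; positivity
  set e := extTuple k with he
  have hek : ∀ i : Fin (M + 1), e i = k i := fun i => by simp [he, extTuple, i.isLt]
  have hsum' : partialSum k M = a := by rw [← sum_univ_eq_partialSum]; exact hsum
  -- the counting bound
  have h1 := card_profSet_le_saw hQ' (partialSum k) M a hsum'
  rw [partialSum_zero] at h1
  have h1' : (profSet d a M (partialSum k)).card ≤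
      2 * d * Q' (e 0 - 1) * ∏ i ∈ Finset.range M, ((e i + 1) * Q' (e (i + 1))) := by
    refine h1.trans (le_of_eq ?_)
    congr 1
    exact Finset.prod_congr rfl fun i _ => by rw [(partialSum_sub M k i).1, (partialSum_sub M k i).2]
  -- `∏_{i<M} (e i + 1) ≤ (e 0 + 1) ∏_{i<M} (e (i+1) + 1)`
  have h2 : (∏ i ∈ Finset.range M, ((e i : ℝ) + 1)) ≤ ((e 0 : ℝ) + 1) * ∏ i ∈ Finset.range M, ((e (i + 1) : ℝ) + 1) := by
    have heq : (∏ i ∈ Finset.range M, ((e i : ℝ) + 1)) * ((e M : ℝ) + 1) =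
        ((e 0 : ℝ) + 1) * ∏ i ∈ Finset.range M, ((e (i + 1) : ℝ) + 1) := by
      rw [← Finset.prod_range_succ (fun i => (e i : ℝ) + 1), Finset.prod_range_succ' (fun i => (e i : ℝ) + 1)]
      ring
    rw [← heq]
    refine le_mul_of_one_le_right (Finset.prod_nonneg fun i _ => by positivity) ?_
    have : (0 : ℝ) ≤ e M := Nat.cast_nonneg _
    linarith
  -- `z^a = z^{e 0} ∏_{i<M} z^{e (i+1)}`
  have hzprod : ∏ i : Fin (M + 1), z ^ (k i) = ∏ j ∈ Finset.range (M + 1), z ^ (e j) := by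
    rw [Finset.prod_range (fun j => z ^ (e j))]
    exact Finset.prod_congr rfl fun i _ => by rw [hek]
  have h3 : z ^ a = z ^ (e 0) * ∏ i ∈ Finset.range M, z ^ (e (i + 1)) := by
    rw [← hsum, ← Finset.prod_pow_eq_pow_sum, hzprod, Finset.prod_range_succ']
    ring
  have he0 : 1 ≤ e 0 := by
    have h := hek 0
    simp only [Fin.val_zero] at h
    rw [h]; exact hpos 0
  have hz0 : z ^ (e 0) = z * z ^ (e 0 - 1) := by
    rw [← pow_succ']; congr 1; omega
  -- the right-hand side as a range product
  have hR' : (∏ i : Fin (M + 1), (if (i : ℕ) = 0 then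
        (((k i - 1 : ℕ) : ℝ) + 1) * (Q' (k i - 1) : ℝ) * z ^ (k i - 1)
        else ((k i : ℝ) + 1) * (Q' (k i) : ℝ) * z ^ (k i))) =
      ∏ j ∈ Finset.range (M + 1), (if j = 0 then w (e j - 1) else w (e j)) := by
    rw [Finset.prod_range (fun j => if j = 0 then w (e j - 1) else w (e j))]
    refine Finset.prod_congr rfl fun i _ => ?_
    simp only [hw, hek]
  have hR : (∏ i : Fin (M + 1), (if (i : ℕ) = 0 then
        (((k i - 1 : ℕ) : ℝ) + 1) * (Q' (k i - 1) : ℝ) * z ^ (k i - 1)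
        else ((k i : ℝ) + 1) * (Q' (k i) : ℝ) * z ^ (k i))) =
      w (e 0 - 1) * ∏ i ∈ Finset.range M, w (e (i + 1)) := by
    rw [hR', Finset.prod_range_succ']
    simp only [Nat.succ_ne_zero, ↓reduceIte]
    ring
  rw [hR]
  calc ((profSet d a M (partialSum k)).card : ℝ) * z ^ a
      ≤ ((2 * d * Q' (e 0 - 1) * ∏ i ∈ Finset.range M, ((e i + 1) * Q' (e (i + 1))) : ℕ) : ℝ) * z ^ a :=
        mul_le_mul_of_nonneg_right (by exact_mod_cast h1') (by positivity)
    _ = (2 * (d : ℝ) * z) * ((Q' (e 0 - 1) : ℝ) * z ^ (e 0 - 1)) * (∏ i ∈ Finset.range M, ((e i : ℝ) + 1)) *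
          ∏ i ∈ Finset.range M, ((Q' (e (i + 1)) : ℝ) * z ^ (e (i + 1))) := by
        rw [h3, hz0]; push_cast
        simp only [Finset.prod_mul_distrib]
        ring
    _ ≤ 2 * ((Q' (e 0 - 1) : ℝ) * z ^ (e 0 - 1)) * (((e 0 : ℝ) + 1) * ∏ i ∈ Finset.range M, ((e (i + 1) : ℝ) + 1)) *
          ∏ i ∈ Finset.range M, ((Q' (e (i + 1)) : ℝ) * z ^ (e (i + 1))) := by
        gcongr
    _ = (2 * ((e 0 : ℝ) + 1) * (Q' (e 0 - 1) : ℝ) * z ^ (e 0 - 1)) * ∏ i ∈ Finset.range M, w (e (i + 1)) := by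
        simp only [hw, Finset.prod_mul_distrib]
        ring
    _ ≤ (4 * w (e 0 - 1)) * ∏ i ∈ Finset.range M, w (e (i + 1)) := by
        refine mul_le_mul_of_nonneg_right ?_ (Finset.prod_nonneg fun i _ => hw0 _)
        simp only [hw]
        have hcast : ((e 0 - 1 : ℕ) : ℝ) + 1 = e 0 := by
          rw [Nat.cast_sub he0]; push_cast; ring
        rw [hcast]
        have : (e 0 : ℝ) + 1 ≤ 2 * e 0 := by
          have : (1 : ℝ) ≤ e 0 := by exact_mod_cast he0
          linarith
        have hnn : 0 ≤ (Q' (e 0 - 1) : ℝ) * z ^ (e 0 - 1) := by positivity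
        nlinarith
    _ = 4 * (w (e 0 - 1) * ∏ i ∈ Finset.range M, w (e (i + 1))) := by ring

/-- The first piece of a lace graph has length `T_0 ≥ 2`. [folklore] -/
theorem two_le_pieceLen_zero {a M : ℕ} {σ : StepSeq d a} (hD : IsDiag σ M) (hT : laceTime σ M = a) :
    2 ≤ pieceLen σ M 0 := by
  have hle : laceTime σ 0 ≤ a := (laceTime_mono σ (Nat.zero_le M)).trans hT.le
  have h2 := two_le_laceTime_zero hle
  have _ := hD.1
  unfold pieceLen
  simp only [Fin.val_zero, ↓reduceIte, Nat.sub_zero]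
  exact h2

/-- **The lace graphs with a long piece, weighted**: for `z ≥ 0` with `2dz ≤ 2` and any `Q'`
with `c_k(x) ≤ Q' k`, writing `w(n) = (n+1) Q'(n) zⁿ`,
`Σ_{a ≤ A} z^a · diagTotalGt d a M K ≤ 4 (M+1) · (Σ_{K ≤ n ≤ A} w n) · (Σ_{1 ≤ n ≤ A} w n)^M`
(one of the `M + 1` pieces is longer than `K` and contributes the tail of `Σ w`; the others, of
positive length, are summed freely). [cite: Graham2010, Lemma 7 and Section 6] -/
theorem sum_diagTotalGt_mul_pow_le {Q' : ℕ → ℕ} (hQ' : ∀ k (x : Site d), countAt d k x ≤ Q' k)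
    {z : ℝ} (hz : 0 ≤ z) (hdz : 2 * (d : ℝ) * z ≤ 2) (M K A : ℕ) :
    ∑ a ∈ Finset.range (A + 1), (diagTotalGt d a M K : ℝ) * z ^ a ≤
      4 * ((M : ℝ) + 1) * (∑ n ∈ Finset.Icc K A, ((n : ℝ) + 1) * (Q' n : ℝ) * z ^ n) *
        (∑ n ∈ Finset.Icc 1 A, ((n : ℝ) + 1) * (Q' n : ℝ) * z ^ n) ^ M := by
  classical
  set w : ℕ → ℝ := fun n => ((n : ℝ) + 1) * (Q' n : ℝ) * z ^ n with hw
  have hw0 : ∀ n, 0 ≤ w n := fun n => by simp only [hw]; positivity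
  set TK : ℝ := ∑ n ∈ Finset.Icc K A, w n with hTK
  set Wall : ℝ := ∑ n ∈ Finset.Icc 1 A, w n with hWall
  have hWall0 : 0 ≤ Wall := Finset.sum_nonneg fun n _ => hw0 n
  have hTK0 : 0 ≤ TK := Finset.sum_nonneg fun n _ => hw0 n
  -- the slot weights: slot `0` carries `w(k₀ - 1)` (`k₀ ≥ 2`), the others `w(k_i)` (`k_i ≥ 1`)
  set φ : Fin (M + 1) → ℕ → ℝ := fun i n => if (i : ℕ) = 0 then (if 2 ≤ n then w (n - 1) else 0)
      else (if 1 ≤ n then w n else 0) with hφ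
  have hφ0 : ∀ i n, 0 ≤ φ i n := fun i n => by
    simp only [hφ]; split_ifs <;> first | exact hw0 _ | exact le_rfl
  set g : (Fin (M + 1) → ℕ) → ℝ := fun k => 4 * ∏ i, φ i (k i) with hg
  have hg0 : ∀ k, 0 ≤ g k := fun k => by
    simp only [hg]; exact mul_nonneg (by norm_num) (Finset.prod_nonneg fun i _ => hφ0 i _)
  -- admissible profiles of length `a`
  set P : ℕ → Finset (Fin (M + 1) → ℕ) := fun a =>
    (Finset.Nat.antidiagonalTuple (M + 1) a).filter fun k => ((∀ i, 1 ≤ k i) ∧ 2 ≤ k 0) ∧ ∃ i, K < k i with hP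
  -- Step 1: per length
  have hstep1 : ∀ a, (diagTotalGt d a M K : ℝ) * z ^ a ≤ ∑ k ∈ P a, g k := by
    intro a
    have hcover : (Finset.univ.filter fun σ : StepSeq d a =>
        (IsDiag σ M ∧ laceTime σ M = a) ∧ ¬ ∀ i : Fin (M + 1), pieceLen σ M i ≤ K) ⊆
        (P a).biUnion fun k => profSet d a M (partialSum k) := by
      intro σ hσ
      rw [Finset.mem_filter] at hσ
      obtain ⟨-, ⟨hD, hT⟩, hK⟩ := hσ
      rw [Finset.mem_biUnion]
      refine ⟨pieceLen σ M, ?_, ?_⟩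
      · simp only [hP]
        rw [Finset.mem_filter]
        refine ⟨pieceLen_mem_antidiagonalTuple hT, ⟨fun i => one_le_pieceLen hT i, two_le_pieceLen_zero hD hT⟩, ?_⟩
        by_contra hno
        exact hK fun i => Nat.le_of_not_lt fun hi => hno ⟨i, hi⟩
      · unfold profSet
        rw [Finset.mem_filter]
        exact ⟨Finset.mem_univ _, hD, laceTime_eq_partialSum σ⟩
    have hcard : diagTotalGt d a M K ≤ ∑ k ∈ P a, (profSet d a M (partialSum k)).card := by
      unfold diagTotalGt
      exact (Finset.card_le_card hcover).trans Finset.card_biUnion_le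
    calc (diagTotalGt d a M K : ℝ) * z ^ a
        ≤ (∑ k ∈ P a, ((profSet d a M (partialSum k)).card : ℝ)) * z ^ a := by
          refine mul_le_mul_of_nonneg_right ?_ (by positivity)
          exact_mod_cast hcard
      _ = ∑ k ∈ P a, ((profSet d a M (partialSum k)).card : ℝ) * z ^ a := Finset.sum_mul _ _ _
      _ ≤ ∑ k ∈ P a, g k := by
          refine Finset.sum_le_sum fun k hk => ?_
          simp only [hP] at hk
          rw [Finset.mem_filter, Finset.Nat.mem_antidiagonalTuple] at hk
          obtain ⟨hsum, ⟨hpos, h2⟩, -⟩ := hk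
          refine (card_profSet_mul_pow_le hQ' hz hdz k hsum hpos).trans (le_of_eq ?_)
          simp only [hg]
          congr 1
          refine Finset.prod_congr rfl fun i _ => ?_
          simp only [hφ, hw]
          by_cases hi : (i : ℕ) = 0
          · have hi0 : i = 0 := Fin.ext hi
            rw [if_pos hi, if_pos hi, hi0, if_pos h2]
          · rw [if_neg hi, if_neg hi, if_pos (hpos i)]
  -- Step 2: collect all lengths into the box of profiles with entries `≤ A`
  set R : Finset (Fin (M + 1) → ℕ) := Fintype.piFinset fun _ : Fin (M + 1) => Finset.range (A + 1) with hR
  have hstep2 : ∑ a ∈ Finset.range (A + 1), ∑ k ∈ P a, g k ≤ ∑ k ∈ R.filter (fun k => ∃ i, K < k i), g k := by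
    have hdisj : Set.PairwiseDisjoint (↑(Finset.range (A + 1)) : Set ℕ) P := by
      intro a _ a' _ hne
      rw [Function.onFun, Finset.disjoint_left]
      intro k hk hk'
      simp only [hP] at hk hk'
      rw [Finset.mem_filter, Finset.Nat.mem_antidiagonalTuple] at hk hk'
      exact hne (hk.1.symm.trans hk'.1)
    rw [← Finset.sum_biUnion hdisj]
    refine Finset.sum_le_sum_of_subset_of_nonneg (fun k hk => ?_) fun k _ _ => hg0 k
    rw [Finset.mem_biUnion] at hk
    obtain ⟨a, ha, hk⟩ := hk
    simp only [hP] at hk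
    rw [Finset.mem_filter, Finset.Nat.mem_antidiagonalTuple] at hk
    rw [Finset.mem_range] at ha
    rw [Finset.mem_filter]
    refine ⟨?_, hk.2.2⟩
    simp only [hR]
    rw [Fintype.mem_piFinset]
    intro i
    rw [Finset.mem_range]
    have : k i ≤ ∑ j, k j := Finset.single_le_sum (fun j _ => Nat.zero_le (k j)) (Finset.mem_univ i)
    omega
  -- Step 3: union bound over the long slot
  have hstep3 : ∑ k ∈ R.filter (fun k => ∃ i, K < k i), g k ≤
      ∑ j : Fin (M + 1), ∑ k ∈ R.filter (fun k => K < k j), g k := by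
    have hsub : R.filter (fun k => ∃ i, K < k i) ⊆ Finset.univ.biUnion fun j => R.filter fun k => K < k j := by
      intro k hk
      rw [Finset.mem_filter] at hk
      obtain ⟨hkR, j, hj⟩ := hk
      rw [Finset.mem_biUnion]
      exact ⟨j, Finset.mem_univ _, Finset.mem_filter.2 ⟨hkR, hj⟩⟩
    exact (Finset.sum_le_sum_of_subset_of_nonneg hsub fun k _ _ => hg0 k).trans
      (real_sum_biUnion_le _ _ _ hg0)
  -- Step 4: for a fixed long slot, the sum factorises; the factor bounds
  have hfull : ∀ i : Fin (M + 1), ∑ n ∈ Finset.range (A + 1), φ i n ≤ Wall := by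
    intro i
    by_cases hi : (i : ℕ) = 0
    · have hφi : ∀ n, φ i n = if 2 ≤ n then w (n - 1) else 0 := fun n => by simp only [hφ, if_pos hi]
      simp_rw [hφi]
      rw [← Finset.sum_filter]
      have hinj : Set.InjOn (fun n : ℕ => n - 1) ↑((Finset.range (A + 1)).filter fun n => 2 ≤ n) := by
        intro n hn n' hn' h
        rw [Finset.coe_filter, Set.mem_setOf_eq] at hn hn'
        simp only at h
        omega
      rw [← Finset.sum_image hinj]
      refine Finset.sum_le_sum_of_subset_of_nonneg (fun m hm => ?_) fun n _ _ => hw0 n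
      rw [Finset.mem_image] at hm
      obtain ⟨n, hn, rfl⟩ := hm
      rw [Finset.mem_filter, Finset.mem_range] at hn
      rw [Finset.mem_Icc]; omega
    · have hφi : ∀ n, φ i n = if 1 ≤ n then w n else 0 := fun n => by simp only [hφ, if_neg hi]
      simp_rw [hφi]
      rw [← Finset.sum_filter]
      refine Finset.sum_le_sum_of_subset_of_nonneg (fun n hn => ?_) fun n _ _ => hw0 n
      rw [Finset.mem_filter, Finset.mem_range] at hn
      rw [Finset.mem_Icc]; omega
  have htail : ∀ i : Fin (M + 1), ∑ n ∈ (Finset.range (A + 1)).filter (fun n => K < n), φ i n ≤ TK := by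
    intro i
    by_cases hi : (i : ℕ) = 0
    · have hφi : ∀ n, φ i n = if 2 ≤ n then w (n - 1) else 0 := fun n => by simp only [hφ, if_pos hi]
      simp_rw [hφi]
      rw [← Finset.sum_filter, Finset.filter_filter]
      have hinj : Set.InjOn (fun n : ℕ => n - 1) ↑((Finset.range (A + 1)).filter fun n => K < n ∧ 2 ≤ n) := by
        intro n hn n' hn' h
        rw [Finset.coe_filter, Set.mem_setOf_eq] at hn hn'
        simp only at h
        omega
      rw [← Finset.sum_image hinj]
      refine Finset.sum_le_sum_of_subset_of_nonneg (fun m hm => ?_) fun n _ _ => hw0 n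
      rw [Finset.mem_image] at hm
      obtain ⟨n, hn, rfl⟩ := hm
      rw [Finset.mem_filter, Finset.mem_range] at hn
      rw [Finset.mem_Icc]; omega
    · have hφi : ∀ n, φ i n = if 1 ≤ n then w n else 0 := fun n => by simp only [hφ, if_neg hi]
      simp_rw [hφi]
      rw [← Finset.sum_filter, Finset.filter_filter]
      refine Finset.sum_le_sum_of_subset_of_nonneg (fun n hn => ?_) fun n _ _ => hw0 n
      rw [Finset.mem_filter, Finset.mem_range] at hn
      rw [Finset.mem_Icc]; omega
  have hstep4 : ∀ j : Fin (M + 1), ∑ k ∈ R.filter (fun k => K < k j), g k ≤ 4 * (TK * Wall ^ M) := by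
    intro j
    set t : Fin (M + 1) → Finset ℕ := fun i =>
      if i = j then (Finset.range (A + 1)).filter (fun n => K < n) else Finset.range (A + 1) with ht
    have hRt : R.filter (fun k => K < k j) = Fintype.piFinset t := by
      ext k
      simp only [hR, ht, Finset.mem_filter, Fintype.mem_piFinset]
      constructor
      · rintro ⟨hk, hK⟩ i
        split_ifs with hij
        · subst hij; exact Finset.mem_filter.2 ⟨hk i, hK⟩
        · exact hk i
      · intro h
        refine ⟨fun i => ?_, ?_⟩
        · have := h i
          split_ifs at this with hij
          · exact (Finset.mem_filter.1 this).1
          · exact this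
        · have := h j
          rw [if_pos rfl] at this
          exact (Finset.mem_filter.1 this).2
    rw [hRt]
    simp only [hg]
    rw [← Finset.mul_sum, ← Finset.prod_univ_sum]
    refine mul_le_mul_of_nonneg_left ?_ (by norm_num)
    set c : Fin (M + 1) → ℝ := fun i => if i = j then TK else Wall with hc
    calc ∏ i, ∑ n ∈ t i, φ i n ≤ ∏ i, c i := by
          refine Finset.prod_le_prod (fun i _ => Finset.sum_nonneg fun n _ => hφ0 i n) fun i _ => ?_
          simp only [ht, hc]
          split_ifs with hij
          · exact htail i
          · exact hfull i
      _ = TK * Wall ^ M := by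
          rw [← Finset.mul_prod_erase Finset.univ c (Finset.mem_univ j)]
          have h1 : c j = TK := by simp [hc]
          have h2 : ∏ i ∈ Finset.univ.erase j, c i = Wall ^ M := by
            rw [Finset.prod_congr rfl (g := fun _ => Wall) ?_, Finset.prod_const,
              Finset.card_erase_of_mem (Finset.mem_univ j), Finset.card_univ, Fintype.card_fin, Nat.add_sub_cancel]
            intro i hi
            rw [Finset.mem_erase] at hi
            simp [hc, hi.1]
          rw [h1, h2]
  -- assemble
  calc ∑ a ∈ Finset.range (A + 1), (diagTotalGt d a M K : ℝ) * z ^ a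
      ≤ ∑ a ∈ Finset.range (A + 1), ∑ k ∈ P a, g k := Finset.sum_le_sum fun a _ => hstep1 a
    _ ≤ ∑ k ∈ R.filter (fun k => ∃ i, K < k i), g k := hstep2
    _ ≤ ∑ j : Fin (M + 1), ∑ k ∈ R.filter (fun k => K < k j), g k := hstep3
    _ ≤ ∑ _j : Fin (M + 1), 4 * (TK * Wall ^ M) := Finset.sum_le_sum fun j _ => hstep4 j
    _ = 4 * ((M : ℝ) + 1) * TK * Wall ^ M := by
        rw [Finset.sum_const, Finset.card_univ, Fintype.card_fin, nsmul_eq_mul]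
        push_cast
        ring

end Literature.Probability.RandomPlanarGeometry.SAW.Zd.Graham2010
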